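import Summits.CriticalPhenomena.PercolationContinuityZ3.Theorems.PercNearOneGluingNoHeavyLowerTailFKCSHPeelTools
import HarnessLib

/-!
# FK sub-lane: (S5D) from CSH under a general measure — the peeling induction (memo Theorem 2, measure-parametrised)

Support file (`--supports stmt-CriticalPhenomena-4575`), FK sub-lane `prim-bschramm-fk-1` (gen 2) of the post-continuity programme;
builds on p205010 (kernel theorem, internal audit signed; external expert review pending).  No definitions, no named facts, no sorries;
standard axioms.  Line-by-line port of prim-hp-8's `CSH.s5dMargin_nonneg_of_csh` (`…NoHeavyLowerTailCSHPeel.lean`, memo PROOF-S5-ALL-R.md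
§4.5) from `prodBernoulli w` to an arbitrary probability measure `μ` with full support on the bond configurations of `Fin n`.

`FK.s5dMarginμ_nonneg_of_cshFor`: IF the conditioned slack hierarchy holds under `μ` (`FK.CSHHoldsFor μ x Y D o v` for every owner /
avoided set / decoy list with the named vertices distinct) THEN `0 ≤ FK.s5dMarginμ μ T r D o v F` for every relay set `T ∌ o, v`, every
injective `m_μ`-compatible rank, every decoy list and every monotone `F`; at `D = []` this is the surplus-transfer inequality (S5) under `μ`
(`FK.hS5_of_s5dMarginμ_nil`).  Nothing about `μ` beyond full support and total mass one is used.  Consumers: `…FKCSHToAdditiveGluing.lean`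
(CSH_μ ⟹ additive gluing under `μ`; `FK.CSHFK q ⟹ FK.AdditiveGluingFK q` for `q ≥ 1`).
[cite: KozmaNitzan2024, Conj. 4 (p. 32)] [cite: VandenbergHaggstromKahn2005, Thm. 1.3 (p. 6)]
-/

noncomputable section

namespace Summit.CriticalPhenomena.PercolationContinuityZ3.Theorems

open MeasureTheory Set Literature.Probability.LatticeModels Literature.Probability.Percolation
open scoped Classical

namespace FK

open KNPreFKG

variable {n : ℕ}


/-- In the empty configuration only trivial connections exist. [folklore] -/
theorem reachable_openGraph_empty_iff {V : Type*} (a b : V) : (openGraph (∅ : Set (Sym2 V))).Reachable a b ↔ a = b := by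
  have hbot : openGraph (∅ : BondConfig V) = ⊥ := by
    unfold openGraph; exact SimpleGraph.fromEdgeSet_empty
  rw [hbot, SimpleGraph.reachable_bot]

/-- **THEOREM 2 of the memo under a general measure: (S5D) — hence (S5) for every number of relays — from the conditioned slack
hierarchy under `μ`.**  For a probability measure `μ` on the bond configurations of `Fin n` giving positive mass to every nonempty event
(full support; for `φ_{w,q}` with `0 < w < 1` this is `rcMeasureW_real_pos_of_nonempty`) and observers `o ≠ v`: IF `FK.CSHHoldsFor μ x Y D o v`
for every owner / avoided set / decoy list with the named vertices distinct, THEN `0 ≤ FK.s5dMarginμ μ T r D o v F` for every relay set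
`T ∌ o, v`, every injective `m_μ`-compatible rank `r`, every decoy list `D` off `T ∪ {o, v}` and every monotone `F`.  Proof = hp-8's
(`CSH.s5dMargin_nonneg_of_csh`, memo §4) line by line: peel the rank-maximal relay (`surplusμ_erase_add`), rewrite its term through `covDμ`
(`covDμ_clusterFun_eq`), bound the deficit (`kappaμ_le_surplus`), get the sign of `Marg[c_k]` from CSH applied to `Ψ_iso`
(`covDμ_psiIso`), recognise the next rung by `CSH.cshMarg_cons`; induction on `|T|`.  No property of `μ` beyond full support and total
mass one is used — the peeling is measure-generic. (transcription of the cell memo prim-hp-8 PROOF-S5-ALL-R.md §4.5, measure-parametrised)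
[cite: KozmaNitzan2024, Conj. 4 (p. 32)] [cite: VandenbergHaggstromKahn2005, Thm. 1.3 (p. 6)] -/
theorem s5dMarginμ_nonneg_of_cshFor (μ : Measure (BondConfig (Fin n))) [IsProbabilityMeasure μ]
    (hfull : ∀ S : Set (BondConfig (Fin n)), S.Nonempty → 0 < μ.real S) (o v : Fin n)
    (hCSH : ∀ (x : Fin n) (Y : Finset (Fin n)) (D : List (Fin n)),
      x ∉ Y → o ≠ x → v ≠ x → o ∉ Y → v ∉ Y → D.Nodup → (∀ d ∈ D, d ≠ x ∧ d ∉ Y ∧ d ≠ o ∧ d ≠ v) →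
      CSHHoldsFor μ x (↑Y : Set (Fin n)) D o v) :
    ∀ (T : Finset (Fin n)) (r : Fin n → ℕ) (D : List (Fin n)) (F : Set (Fin n) → ℝ),
      (∀ S S' : Set (Fin n), S ⊆ S' → F S ≤ F S') → Set.InjOn r ↑T →
      (∀ a ∈ T, ∀ a' ∈ T, r a < r a' → ∫ ω, F (openCluster ω a) ∂μ ≤ ∫ ω, F (openCluster ω a') ∂μ) →
      o ∉ T → v ∉ T → D.Nodup → (∀ d ∈ D, d ∉ T ∧ d ≠ o ∧ d ≠ v) →
      0 ≤ s5dMarginμ μ T r D o v F := by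
  classical
  -- strong induction on `|T|`
  have main : ∀ (N : ℕ) (T : Finset (Fin n)) (r : Fin n → ℕ) (D : List (Fin n)) (F : Set (Fin n) → ℝ), T.card = N →
      (∀ S S' : Set (Fin n), S ⊆ S' → F S ≤ F S') → Set.InjOn r ↑T →
      (∀ a ∈ T, ∀ a' ∈ T, r a < r a' → ∫ ω, F (openCluster ω a) ∂μ ≤ ∫ ω, F (openCluster ω a') ∂μ) →
      o ∉ T → v ∉ T → D.Nodup → (∀ d ∈ D, d ∉ T ∧ d ≠ o ∧ d ≠ v) →
      0 ≤ s5dMarginμ μ T r D o v F := by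
    intro N
    induction N using Nat.strong_induction_on with
    | _ N ih =>
    intro T r D F hN hF hr hcompat hoT hvT hD hDT
    have hmeas : ∀ S : Set (BondConfig (Fin n)), MeasurableSet S := fun _ => MeasurableSet.of_discrete
    have hn := fun (S : Set (BondConfig (Fin n))) => (measureReal_nonneg : 0 ≤ μ.real S)
    rcases T.eq_empty_or_nonempty with hT0 | hne
    · -- no relays: the surplus vanishes identically
      subst hT0
      rw [s5dMarginμ, surplusμ_empty]
      have := CSH.slForm_zero (decoyListμ μ (↑(∅ : Finset (Fin n)) : Set (Fin n)) D)
      simp only [CSH.cshMarg]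
      rw [show (fun _ : Fin n => (0 : ℝ)) = (0 : Fin n → ℝ) from rfl, this]
      simp
    -- the rank-maximal relay `k` and `T' = T.erase k`
    obtain ⟨k, hkT, hkmax⟩ := Finset.exists_max_image T r hne
    set T' : Finset (Fin n) := T.erase k with hT'
    have hTcard : T'.card < N := by
      have hpos : 0 < T.card := Finset.card_pos.2 hne
      rw [hT', Finset.card_erase_of_mem hkT]; omega
    have hT'T : ∀ a ∈ T', a ∈ T := fun a ha => Finset.mem_of_mem_erase ha
    have hkT' : k ∉ T' := Finset.notMem_erase k T
    have hlt : ∀ a ∈ T', r a < r k := by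
      intro a ha
      rcases (hkmax a (hT'T a ha)).lt_or_eq with h | h
      · exact h
      · exact absurd (hr (hT'T a ha) hkT h) (Finset.ne_of_mem_erase ha)
    have hrT' : Set.InjOn r ↑T' := hr.mono (by intro a ha; exact hT'T a ha)
    have hcompatT' : ∀ a ∈ T', ∀ a' ∈ T', r a < r a' →
        ∫ ω, F (openCluster ω a) ∂μ ≤ ∫ ω, F (openCluster ω a') ∂μ :=
      fun a ha a' ha' h => hcompat a (hT'T a ha) a' (hT'T a' ha') h
    have hmle : ∀ a ∈ T', ∫ ω, F (openCluster ω a) ∂μ ≤ ∫ ω, F (openCluster ω k) ∂μ :=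
      fun a ha => hcompat a (hT'T a ha) k hkT (hlt a ha)
    have hko : o ≠ k := fun h => hoT (h ▸ hkT)
    have hkv : v ≠ k := fun h => hvT (h ▸ hkT)
    have hkD : k ∉ D := fun h => (hDT k h).1 hkT
    -- the objects
    set Dk : Set (BondConfig (Fin n)) := {ω : BondConfig (Fin n) | ∀ a ∈ (↑T' : Set (Fin n)), ¬ (openGraph ω).Reachable k a}
      with hDk
    set mk : ℝ := ∫ ω, F (openCluster ω k) ∂μ with hmk
    set κ : ℝ := mk * μ.real Dk - ∫ ω in Dk, F (openCluster ω k) ∂μ with hκ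
    set L := decoyListμ μ (↑T : Set (Fin n)) D with hL
    set p : ℝ := obsConstμ μ o v ((↑T : Set (Fin n)) ∪ {d | d ∈ D}) with hp
    set ck : Fin n → ℝ := avoidConstμ μ k (↑T' : Set (Fin n)) with hck
    set Fh : Set (Sym2 (Fin n)) → ℝ := fun C => F {a | a = k ∨ ∃ e ∈ C, a ∈ e} with hFh
    set Tk : Fin n → ℝ := fun u => (∫ ω in Dk ∩ openConn k u, F (openCluster ω k) ∂μ) - μ.real (Dk ∩ openConn k u) * mk
      with hTk
    -- positivity of the conditioning events (full support)
    have hempty_Dk : (∅ : BondConfig (Fin n)) ∈ Dk := by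
      intro a ha h
      rw [reachable_openGraph_empty_iff] at h
      exact hkT' (h ▸ (Finset.mem_coe.1 ha))
    have hDkpos : 0 < μ.real Dk := hfull _ ⟨∅, hempty_Dk⟩
    have hisopos : 0 < μ.real (Dk ∩ {ω | openEdgeCluster ω k = ∅}) :=
      hfull _ ⟨∅, hempty_Dk, subset_empty_iff.1 (openEdgeCluster_subset ∅ k)⟩
    -- set identities between the systems `(T; D)`, `(T'; k; D)` and `(T'; k :: D)`
    have hins : insert k (↑T' : Set (Fin n)) = ↑T := by
      rw [hT', Finset.coe_erase, insert_sdiff_singleton, insert_eq_of_mem (Finset.mem_coe.2 hkT)]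
    have hset2 : (↑T' : Set (Fin n)) ∪ {d | d ∈ k :: D} = (↑T : Set (Fin n)) ∪ {d | d ∈ D} := by
      ext a
      simp only [mem_union, Finset.mem_coe, hT', Finset.mem_erase, mem_setOf_eq, List.mem_cons]
      constructor
      · rintro (⟨_, ha⟩ | rfl | ha)
        · exact Or.inl ha
        · exact Or.inl hkT
        · exact Or.inr ha
      · rintro (ha | ha)
        · by_cases hak : a = k
          · exact Or.inr (Or.inl hak)
          · exact Or.inl ⟨hak, ha⟩
        · exact Or.inr (Or.inr ha)
    have hcshMargin : ∀ f : Set (Sym2 (Fin n)) → ℝ,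
        cshMarginμ μ k (↑T' : Set (Fin n)) D o v f = CSH.cshMarg L p o v (covDμ μ k (↑T' : Set (Fin n)) f) := by
      intro f
      rw [cshMarginμ, hins]
    have hnext : s5dMarginμ μ T' r (k :: D) o v F =
        CSH.cshMarg L p o v (surplusμ μ T' r F) - surplusμ μ T' r F k * CSH.cshMarg L p o v ck := by
      rw [s5dMarginμ, hset2, decoyListμ, hins, CSH.cshMarg_cons]
    -- (1) Lemma P: peel `k`
    have hpeel : surplusμ μ T r F = (surplusμ μ T' r F) + Tk := by
      funext u
      rw [Pi.add_apply, surplusμ_erase_add μ T r F hkT hlt u]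
    -- (2) the top-relay term through `covDμ`
    have hTk_cov : (μ.real Dk) • Tk = covDμ μ k (↑T' : Set (Fin n)) Fh - (κ * μ.real Dk) • ck := by
      funext u
      simp only [Pi.smul_apply, Pi.sub_apply, smul_eq_mul]
      have h1 := covDμ_clusterFun_eq μ T' F k u
      have h2 : μ.real (Dk ∩ openConn k u) = μ.real Dk * ck u := by
        simp only [hck, avoidConstμ, hDk]
        rw [mul_div_cancel₀ _ (ne_of_gt hDkpos)]
      simp only [hTk, hFh, hκ, hmk, hDk] at h1 h2 ⊢
      rw [h1, h2]
      ring
    -- (3) CSH for the peeled relay, functional `F̂`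
    have hCSHk := hCSH k T' D hkT' hko hkv (fun h => hoT (hT'T o h)) (fun h => hvT (hT'T v h)) hD
      (fun d hd => ⟨fun h => hkD (h ▸ hd), fun h => (hDT d hd).1 (hT'T d h), (hDT d hd).2.1, (hDT d hd).2.2⟩)
    have h3 : 0 ≤ CSH.cshMarg L p o v (covDμ μ k (↑T' : Set (Fin n)) Fh) := by
      rw [← hcshMargin]
      exact hCSHk Fh (monotone_clusterFun k F hF)
    -- (4) Lemma AC: `Marg[c_k] ≥ 0` from CSH applied to `Ψ_iso`
    have h4 : 0 ≤ CSH.cshMarg L p o v ck := by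
      have hiso := hCSHk CSH.psiIso CSH.psiIso_mono
      rw [hcshMargin] at hiso
      have hLk : ∀ dc ∈ L, dc.1 ≠ k := fun dc hdc h => hkD (h ▸ mem_decoyListμ μ _ D dc hdc)
      rw [CSH.cshMarg_congr L p o v (covDμ μ k (↑T' : Set (Fin n)) CSH.psiIso)
        ((μ.real (Dk ∩ {ω | openEdgeCluster ω k = ∅}) * μ.real Dk) • ck) (fun u => u ≠ k) hLk hko hkv
        (fun u hu => by
          rw [covDμ_psiIso μ T' k u hu, Pi.smul_apply, smul_eq_mul]
          simp only [hck, avoidConstμ, hDk]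
          rw [mul_assoc, mul_div_cancel₀ _ (ne_of_gt hDkpos)]), CSH.cshMarg_smul] at hiso
      exact (mul_nonneg_iff_of_pos_left (mul_pos hisopos hDkpos)).1 hiso
    -- (5) Lemma κ
    have h5 : κ ≤ surplusμ μ T' r F k := kappaμ_le_surplus μ T' r F k hrT' hmle
    -- (6) the next rung by induction
    have h6 : 0 ≤ s5dMarginμ μ T' r (k :: D) o v F :=
      ih T'.card hTcard T' r (k :: D) F rfl hF hrT' hcompatT' (fun h => hoT (hT'T o h)) (fun h => hvT (hT'T v h))
        (List.nodup_cons.2 ⟨hkD, hD⟩)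
        (fun d hd => by
          rcases List.mem_cons.1 hd with rfl | hd
          · exact ⟨hkT', hko.symm, hkv.symm⟩
          · exact ⟨fun h => (hDT d hd).1 (hT'T d h), (hDT d hd).2.1, (hDT d hd).2.2⟩)
    -- (7) assemble: `μ(Dk) · s5dMargin(T; D) ≥ μ(Dk) · s5dMargin(T'; k :: D) ≥ 0`
    have hmain : μ.real Dk * s5dMarginμ μ T r D o v F =
        μ.real Dk * CSH.cshMarg L p o v (surplusμ μ T' r F) + CSH.cshMarg L p o v (covDμ μ k (↑T' : Set (Fin n)) Fh) -
          κ * μ.real Dk * CSH.cshMarg L p o v ck := by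
      have e1 : μ.real Dk * CSH.cshMarg L p o v Tk =
          CSH.cshMarg L p o v (covDμ μ k (↑T' : Set (Fin n)) Fh) - κ * μ.real Dk * CSH.cshMarg L p o v ck := by
        rw [← CSH.cshMarg_smul, hTk_cov, CSH.cshMarg_sub, CSH.cshMarg_smul]
      rw [s5dMarginμ, ← hL, ← hp, hpeel, CSH.cshMarg_add, mul_add, e1]
      ring
    have hbound : μ.real Dk * s5dMarginμ μ T' r (k :: D) o v F ≤ μ.real Dk * s5dMarginμ μ T r D o v F := by
      rw [hmain, hnext]
      have := mul_le_mul_of_nonneg_right h5 (mul_nonneg hDkpos.le h4)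
      nlinarith [h3, h4, this, hDkpos.le]
    exact le_of_mul_le_mul_left (by linarith [mul_nonneg hDkpos.le h6]) hDkpos
  intro T r D F hF hr hcompat hoT hvT hD hDT
  exact main T.card T r D F rfl hF hr hcompat hoT hvT hD hDT

end FK

end Summit.CriticalPhenomena.PercolationContinuityZ3.Theorems

end
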